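import Literature.Combinatorics.Optimization.ExactDesignRemainder
import HarnessLib

/-!
# Exact extrapolation designs price POLYNOMIALLY WEIGHTED profiles: the weighted Newton remainder

A quadrature/extrapolation rule `(C, w)` on odd natural nodes `c ≤ T` that is EXACT at `0` in degree `≤ D`
(`Σ_c w_c p(c) = −p(0)` for every real polynomial of degree `≤ D`, total variation `Σ_c |w_c| ≤ B`; the
cell's `IsExactDesign n t T D B C w` of `TracialDesigns.lean`) prices a level profile `φ` by its Newton
extrapolation to the virtual level `0` up to `B·C((T−1)/2, D+1)·max_j |Δ^{D+1}ψ|`, `ψ(j) = φ(2j+1)`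
(`ExactDesignRemainder`, `abs_levelSum_add_le_of_exact_of_fwdDiff_odd`). This file records the variant
for a PRODUCT `p(c)·Φ(c)` of a polynomial WEIGHT `p` of degree `≤ a` and a profile `Φ` whose step-2
differences of the REDUCED order `D − a + 1` are small: since `p·N^{odd}_{D−a}Φ` is a polynomial of degree
`≤ D`, it is priced EXACTLY, at `−p(0)·N^{odd}_{D−a}Φ(0)`, and only the Newton remainder of `Φ` of order
`D − a` is paid for, weighted by `max_{c ∈ C}|p(c)|`:

* `levelSum_mul_add_eq_of_exact` — Lebesgue's identity for the product:
  `Σ_c w_c p(c)Φ(c) + p(0)·N^{odd}_{D'}Φ(0) = Σ_c w_c p(c)·(Φ(c) − N^{odd}_{D'}Φ(c))` whenever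
  `deg p + D' ≤ D`;
* **`abs_levelSum_mul_add_le_of_exact_of_fwdDiff_odd`** — if `|p(c)| ≤ P` on the nodes and
  `|Δ^{D'+1}ψ(j)| ≤ K` for `2(j+D'+1)+1 ≤ T` (`ψ(j) = Φ(2j+1)`), then
  `|Σ_c w_c p(c)Φ(c) + p(0)·N^{odd}_{D'}Φ(0)| ≤ B·P·C((T−1)/2, D'+1)·K`;
* **`IsExactDesign.abs_levelSum_mul_add_le_of_fwdDiff_odd`** — the same for `IsExactDesign n t T D B C w`;
* `IsExactDesign.levelSum_mul_le_of_fwdDiff_odd` — the one-sided form used for pricing: if moreover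
  `p(0)·N^{odd}_{D'}Φ(0) ≥ 0` then `Σ_c w_c p(c)Φ(c) ≤ B·P·C((T−1)/2, D'+1)·K`.
* §3 (v2) THE BASE-SHIFTED FORM — when the weight `p` VANISHES on the nodes below a base level `2i₀+1` (e.g.
  `p(c) ∝ c(c−1)⋯(c−g+1)`), only the profile ABOVE the base has to be smooth: with the Newton polynomial of the
  shifted profile `c ↦ Φ(c + 2i₀)` (nodes `2i₀+1, 2i₀+3, …`),
  **`abs_levelSum_mul_add_le_of_exact_of_fwdDiff_odd_shift`** /
  **`IsExactDesign.abs_levelSum_mul_add_le_of_fwdDiff_odd_shift`**: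
  `|Σ_c w_c p(c)Φ(c) + p(0)·N^{odd}_{D'}[Φ(· + 2i₀)](−2i₀)| ≤ B·P·C((T−1)/2, D'+1)·K` where `K` bounds
  `|Δ^{D'+1}[j ↦ Φ(2(j+i₀)+1)]|` only; `IsExactDesign.levelSum_mul_le_of_fwdDiff_odd_shift` (one-sided) and
  `IsExactDesign.abs_levelSum_mul_le_of_eval_zero` (`p(0) = 0`: the class carries NO virtual weight and is pure
  remainder).

Reading for the cell pnp-psdrank (eng MEMO-23 §2): the shell profile of a block of `H`-type `(a,b,d)` is a
mixture `Σ_{f,g} p_{fg}(c)·Φ_{fg}(c)` over the states of the `a` internal matching edges with weights that are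
POLYNOMIALS OF DEGREE `a` IN THE LEVEL and vanish at the virtual level `c = 0` unless `g = 0` — this lemma is
what turns that structure into a pricing theorem. Nothing here is specific to matchings.

## References

* [Agarwal2000DifferenceEquations] R. P. Agarwal, *Difference Equations and Inequalities*, 2nd ed., Marcel
  Dekker, 2000, §1.8, Theorem 1.8.5 (1.8.6) and Remark 1.8.1 (1.8.8) (Newton's formula with remainder).
* [Rivlin1974] T. J. Rivlin, *The Chebyshev Polynomials*, Wiley, 1974, Sect. 1.3 (1.32)–(1.34) (Lebesgue's
  inequality: the error of an exact rule only sees the distance to `𝒫_D`).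
-/

noncomputable section

open Finset Polynomial

namespace Literature.Combinatorics.Optimization

open DesignRemainder

/-! ### §1 The weighted Lebesgue identity and the weighted remainder bound for an exact rule -/

section ExactRule

variable {C : Finset ℕ} {w : ℕ → ℝ} {D : ℕ}

/-- **Lebesgue's identity for a polynomially weighted profile**: if the rule is exact at `0` in degree
`≤ D` and `deg p + D' ≤ D`, then `Σ_c w_c p(c)Φ(c) + p(0)·N^{odd}_{D'}Φ(0) = Σ_c w_c p(c)(Φ(c) − N^{odd}_{D'}Φ(c))`
(`p · N^{odd}_{D'}Φ` has degree `≤ D`, so it is priced exactly). [cite: Rivlin1974, Sect. 1.3 (1.32)–(1.34)] -/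
theorem levelSum_mul_add_eq_of_exact
    (hex : ∀ q : ℝ[X], q.natDegree ≤ D → ∑ c ∈ C, w c * q.eval (c : ℝ) = -q.eval 0)
    (p : ℝ[X]) {D' : ℕ} (hp : p.natDegree + D' ≤ D) (Φ : ℕ → ℝ) :
    ∑ c ∈ C, w c * (p.eval (c : ℝ) * Φ c) + p.eval 0 * (newtonPolyOdd D' Φ).eval 0 =
      ∑ c ∈ C, w c * (p.eval (c : ℝ) * (Φ c - (newtonPolyOdd D' Φ).eval (c : ℝ))) := by
  have hdeg : (p * newtonPolyOdd D' Φ).natDegree ≤ D :=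
    natDegree_mul_le.trans ((Nat.add_le_add_left (natDegree_newtonPolyOdd_le D' Φ) _).trans hp)
  have h := hex _ hdeg
  simp only [eval_mul] at h
  have e : ∑ c ∈ C, w c * (p.eval (c : ℝ) * (Φ c - (newtonPolyOdd D' Φ).eval (c : ℝ))) =
      ∑ c ∈ C, w c * (p.eval (c : ℝ) * Φ c) - ∑ c ∈ C, w c * (p.eval (c : ℝ) * (newtonPolyOdd D' Φ).eval (c : ℝ)) := by
    rw [← sum_sub_distrib]
    refine sum_congr rfl fun c _ => ?_
    ring
  rw [e, h]
  ring

/-- **The weighted Newton remainder bound**: for a rule exact at `0` in degree `≤ D` with ODD nodes `≤ T`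
and `Σ_c |w_c| ≤ B`, a polynomial weight `p` with `deg p + D' ≤ D` and `|p(c)| ≤ P` on the nodes, and a
profile `Φ` with `|Δ^{D'+1}ψ(j)| ≤ K` whenever `2(j+D'+1)+1 ≤ T` (`ψ(j) = Φ(2j+1)`):
`|Σ_c w_c p(c)Φ(c) + p(0)·N^{odd}_{D'}Φ(0)| ≤ B·P·C((T−1)/2, D'+1)·K`.
[cite: Agarwal2000DifferenceEquations, Remark 1.8.1 (1.8.8)] [cite: Rivlin1974, Sect. 1.3 (1.32)–(1.34)] -/
theorem abs_levelSum_mul_add_le_of_exact_of_fwdDiff_odd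
    (hex : ∀ q : ℝ[X], q.natDegree ≤ D → ∑ c ∈ C, w c * q.eval (c : ℝ) = -q.eval 0)
    {B : ℝ} (hB : ∑ c ∈ C, |w c| ≤ B) {T : ℕ} (hT : ∀ c ∈ C, c ≤ T) (hodd : ∀ c ∈ C, Odd c)
    (p : ℝ[X]) {D' : ℕ} (hp : p.natDegree + D' ≤ D) {P : ℝ} (hP : ∀ c ∈ C, |p.eval (c : ℝ)| ≤ P)
    (Φ : ℕ → ℝ) {K : ℝ} (hK0 : 0 ≤ K)
    (hK : ∀ j : ℕ, 2 * (j + D' + 1) + 1 ≤ T →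
      |((fwdDiff (1 : ℕ))^[D' + 1] (fun j => Φ (2 * j + 1))) j| ≤ K) :
    |∑ c ∈ C, w c * (p.eval (c : ℝ) * Φ c) + p.eval 0 * (newtonPolyOdd D' Φ).eval 0| ≤
      B * P * ((((T - 1) / 2).choose (D' + 1) : ℕ) : ℝ) * K := by
  obtain ⟨c₀, hc₀⟩ := nonempty_of_exact hex
  have hP0 : 0 ≤ P := (abs_nonneg _).trans (hP c₀ hc₀)
  rw [levelSum_mul_add_eq_of_exact hex p hp Φ]
  -- the remainder at an odd node `c = 2j+1 ≤ T`
  have hη : ∀ c ∈ C, |Φ c - (newtonPolyOdd D' Φ).eval (c : ℝ)| ≤ ((((T - 1) / 2).choose (D' + 1) : ℕ) : ℝ) * K := by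
    intro c hc
    obtain ⟨j, hj⟩ := hodd c hc
    rw [hj, show ((2 * j + 1 : ℕ) : ℝ) = (((2 * j + 1 : ℕ) : ℕ) : ℝ) from rfl, sub_newtonPolyOdd_eval]
    have hjT : j ≤ (T - 1) / 2 := by
      have := hT c hc; rw [hj] at this; omega
    calc |newtonRem D' j (fun j => Φ (2 * j + 1))|
        ≤ ((j.choose (D' + 1) : ℕ) : ℝ) * K :=
          abs_newtonRem_le D' j _ fun j' hj' => hK j' (by have := hT c hc; rw [hj] at this; omega)
      _ ≤ ((((T - 1) / 2).choose (D' + 1) : ℕ) : ℝ) * K :=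
          mul_le_mul_of_nonneg_right (Nat.cast_le.2 (Nat.choose_le_choose _ hjT)) hK0
  calc |∑ c ∈ C, w c * (p.eval (c : ℝ) * (Φ c - (newtonPolyOdd D' Φ).eval (c : ℝ)))|
      ≤ ∑ c ∈ C, |w c * (p.eval (c : ℝ) * (Φ c - (newtonPolyOdd D' Φ).eval (c : ℝ)))| := abs_sum_le_sum_abs _ _
    _ ≤ ∑ c ∈ C, |w c| * (P * (((((T - 1) / 2).choose (D' + 1) : ℕ) : ℝ) * K)) := sum_le_sum fun c hc => by
        rw [abs_mul, abs_mul]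
        refine mul_le_mul_of_nonneg_left ?_ (abs_nonneg _)
        exact mul_le_mul (hP c hc) (hη c hc) (abs_nonneg _) hP0
    _ = (∑ c ∈ C, |w c|) * (P * (((((T - 1) / 2).choose (D' + 1) : ℕ) : ℝ) * K)) := by rw [sum_mul]
    _ ≤ B * (P * (((((T - 1) / 2).choose (D' + 1) : ℕ) : ℝ) * K)) :=
        mul_le_mul_of_nonneg_right hB (by positivity)
    _ = B * P * ((((T - 1) / 2).choose (D' + 1) : ℕ) : ℝ) * K := by ring

end ExactRule

/-! ### §2 The bounds for an exact extrapolation design `IsExactDesign n t T D B C w` -/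

namespace IsExactDesign

variable {n t T D : ℕ} {B : ℝ} {C : Finset ℕ} {w : ℕ → ℝ}

/-- **Exact designs price polynomially weighted profiles**: for `IsExactDesign n t T D B C w`, a polynomial
weight `p` with `deg p + D' ≤ D` and `|p(c)| ≤ P` on the levels of the design, and a profile `Φ` with
`|Δ^{D'+1}ψ(j)| ≤ K` for `2(j+D'+1)+1 ≤ T` (`ψ(j) = Φ(2j+1)`):
`|Σ_c w_c p(c)Φ(c) + p(0)·N^{odd}_{D'}Φ(0)| ≤ B·P·C((T−1)/2, D'+1)·K`.
[cite: Agarwal2000DifferenceEquations, Remark 1.8.1 (1.8.8)] [cite: Rivlin1974, Sect. 1.3 (1.32)–(1.34)] -/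
theorem abs_levelSum_mul_add_le_of_fwdDiff_odd (h : IsExactDesign n t T D B C w)
    (p : ℝ[X]) {D' : ℕ} (hp : p.natDegree + D' ≤ D) {P : ℝ} (hP : ∀ c ∈ C, |p.eval (c : ℝ)| ≤ P)
    (Φ : ℕ → ℝ) {K : ℝ} (hK0 : 0 ≤ K)
    (hK : ∀ j : ℕ, 2 * (j + D' + 1) + 1 ≤ T →
      |((fwdDiff (1 : ℕ))^[D' + 1] (fun j => Φ (2 * j + 1))) j| ≤ K) :
    |∑ c ∈ C, w c * (p.eval (c : ℝ) * Φ c) + p.eval 0 * (newtonPolyOdd D' Φ).eval 0| ≤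
      B * P * ((((T - 1) / 2).choose (D' + 1) : ℕ) : ℝ) * K :=
  abs_levelSum_mul_add_le_of_exact_of_fwdDiff_odd h.exact h.variation_le h.level_le
    (fun c hc => (h.2.2.2.1 c hc).1) p hp hP Φ hK0 hK

/-- **The one-sided pricing form**: under the hypotheses of `abs_levelSum_mul_add_le_of_fwdDiff_odd`, if
the exactly priced main term is nonnegative, `0 ≤ p(0)·N^{odd}_{D'}Φ(0)`, then
`Σ_c w_c p(c)Φ(c) ≤ B·P·C((T−1)/2, D'+1)·K`.
[cite: Agarwal2000DifferenceEquations, Remark 1.8.1 (1.8.8)] [cite: Rivlin1974, Sect. 1.3 (1.32)–(1.34)] -/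
theorem levelSum_mul_le_of_fwdDiff_odd (h : IsExactDesign n t T D B C w)
    (p : ℝ[X]) {D' : ℕ} (hp : p.natDegree + D' ≤ D) {P : ℝ} (hP : ∀ c ∈ C, |p.eval (c : ℝ)| ≤ P)
    (Φ : ℕ → ℝ) {K : ℝ} (hK0 : 0 ≤ K)
    (hK : ∀ j : ℕ, 2 * (j + D' + 1) + 1 ≤ T →
      |((fwdDiff (1 : ℕ))^[D' + 1] (fun j => Φ (2 * j + 1))) j| ≤ K)
    (hmain : 0 ≤ p.eval 0 * (newtonPolyOdd D' Φ).eval 0) :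
    ∑ c ∈ C, w c * (p.eval (c : ℝ) * Φ c) ≤ B * P * ((((T - 1) / 2).choose (D' + 1) : ℕ) : ℝ) * K := by
  have h2 := (abs_le.1 (h.abs_levelSum_mul_add_le_of_fwdDiff_odd p hp hP Φ hK0 hK)).2
  linarith

end IsExactDesign

/-! ### §3 (v2) The base-shifted form: weights vanishing below a base level -/

section ExactRuleShift

variable {C : Finset ℕ} {w : ℕ → ℝ} {D : ℕ}

/-- **The weighted Newton remainder bound, base-shifted.** For a rule exact at `0` in degree `≤ D` with ODD nodes
`≤ T` and `Σ_c |w_c| ≤ B`, a polynomial weight `p` with `deg p + D' ≤ D` that VANISHES on the nodes below the base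
level `2i₀+1` and has `|p(c)| ≤ P` on all nodes, and a profile `Φ` whose shifted odd subsequence
`ψ(j) = Φ(2(j+i₀)+1)` has `|Δ^{D'+1}ψ(j)| ≤ K` whenever `2(j+i₀+D'+1)+1 ≤ T`:
`|Σ_c w_c p(c)Φ(c) + p(0)·N^{odd}_{D'}[Φ(· + 2i₀)](−2i₀)| ≤ B·P·C((T−1)/2, D'+1)·K` — the comparison polynomial
is `p · (N^{odd}_{D'}[Φ(·+2i₀)] ∘ (X − 2i₀))`, of degree `≤ D`; below the base the weight kills the error, above it
the error is the Newton remainder from the base. [cite: Agarwal2000DifferenceEquations, Remark 1.8.1 (1.8.8)]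
[cite: Rivlin1974, Sect. 1.3 (1.32)–(1.34)] -/
theorem abs_levelSum_mul_add_le_of_exact_of_fwdDiff_odd_shift
    (hex : ∀ q : ℝ[X], q.natDegree ≤ D → ∑ c ∈ C, w c * q.eval (c : ℝ) = -q.eval 0)
    {B : ℝ} (hB : ∑ c ∈ C, |w c| ≤ B) {T : ℕ} (hT : ∀ c ∈ C, c ≤ T) (hodd : ∀ c ∈ C, Odd c)
    (p : ℝ[X]) {D' i₀ : ℕ} (hp : p.natDegree + D' ≤ D)
    (hp0 : ∀ c ∈ C, c < 2 * i₀ + 1 → p.eval (c : ℝ) = 0) {P : ℝ} (hP : ∀ c ∈ C, |p.eval (c : ℝ)| ≤ P)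
    (Φ : ℕ → ℝ) {K : ℝ} (hK0 : 0 ≤ K)
    (hK : ∀ j : ℕ, 2 * (j + i₀ + D' + 1) + 1 ≤ T →
      |((fwdDiff (1 : ℕ))^[D' + 1] (fun j => Φ (2 * (j + i₀) + 1))) j| ≤ K) :
    |∑ c ∈ C, w c * (p.eval (c : ℝ) * Φ c) +
        p.eval 0 * (newtonPolyOdd D' (fun c => Φ (c + 2 * i₀))).eval (-(2 * i₀ : ℝ))| ≤
      B * P * ((((T - 1) / 2).choose (D' + 1) : ℕ) : ℝ) * K := by
  obtain ⟨c₀, hc₀⟩ := nonempty_of_exact hex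
  have hP0 : 0 ≤ P := (abs_nonneg _).trans (hP c₀ hc₀)
  set Φ₀ : ℕ → ℝ := fun c => Φ (c + 2 * i₀) with hΦ₀
  set Q₀ := newtonPolyOdd D' Φ₀ with hQ₀
  set Q : ℝ[X] := Q₀.comp (X - Polynomial.C ((2 * i₀ : ℕ) : ℝ)) with hQ
  -- degrees and the exactly priced part
  have hQdeg : Q.natDegree ≤ D' := by
    rw [hQ]
    refine natDegree_comp_le.trans ?_
    have h1 : (X - Polynomial.C ((2 * i₀ : ℕ) : ℝ)).natDegree ≤ 1 := (natDegree_X_sub_C _).le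
    calc Q₀.natDegree * (X - Polynomial.C ((2 * i₀ : ℕ) : ℝ)).natDegree ≤ D' * 1 :=
          Nat.mul_le_mul (natDegree_newtonPolyOdd_le D' Φ₀) h1
      _ = D' := mul_one _
  have hdeg : (p * Q).natDegree ≤ D := natDegree_mul_le.trans ((Nat.add_le_add_left hQdeg _).trans hp)
  have hexQ := hex _ hdeg
  simp only [eval_mul] at hexQ
  have hQ0 : Q.eval 0 = Q₀.eval (-(2 * i₀ : ℝ)) := by
    rw [hQ, eval_comp]; simp
  have hQc : ∀ i : ℕ, Q.eval (((2 * (i + i₀) + 1 : ℕ) : ℝ)) = Q₀.eval (((2 * i + 1 : ℕ) : ℝ)) := by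
    intro i; rw [hQ, eval_comp]; congr 1; simp; ring
  -- Lebesgue's identity for the product
  have hid : ∑ c ∈ C, w c * (p.eval (c : ℝ) * Φ c) + p.eval 0 * Q₀.eval (-(2 * i₀ : ℝ)) =
      ∑ c ∈ C, w c * (p.eval (c : ℝ) * (Φ c - Q.eval (c : ℝ))) := by
    have e : ∑ c ∈ C, w c * (p.eval (c : ℝ) * (Φ c - Q.eval (c : ℝ))) =
        ∑ c ∈ C, w c * (p.eval (c : ℝ) * Φ c) - ∑ c ∈ C, w c * (p.eval (c : ℝ) * Q.eval (c : ℝ)) := by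
      rw [← sum_sub_distrib]; refine sum_congr rfl fun c _ => ?_; ring
    rw [e, hexQ, hQ0]; ring
  rw [hid]
  -- termwise: below the base the weight vanishes, above it the Newton remainder from the base
  have hterm : ∀ c ∈ C, |p.eval (c : ℝ) * (Φ c - Q.eval (c : ℝ))| ≤
      P * (((((T - 1) / 2).choose (D' + 1) : ℕ) : ℝ) * K) := by
    intro c hc
    by_cases hlt : c < 2 * i₀ + 1
    · rw [hp0 c hc hlt, zero_mul, abs_zero]; positivity
    obtain ⟨j, hj⟩ := hodd c hc
    obtain ⟨i, rfl⟩ : ∃ i, j = i + i₀ := ⟨j - i₀, by omega⟩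
    have hcT : 2 * (i + i₀) + 1 ≤ T := by have := hT c hc; rw [hj] at this; exact this
    rw [abs_mul]
    refine mul_le_mul (hP c hc) ?_ (abs_nonneg _) hP0
    have hΦc : Φ c = Φ₀ (2 * i + 1) := by rw [hΦ₀]; simp only; congr 1; rw [hj]; ring
    rw [hj, show ((2 * (i + i₀) + 1 : ℕ) : ℝ) = (((2 * (i + i₀) + 1 : ℕ) : ℕ) : ℝ) from rfl, hQc i,
      show ((2 * i + 1 : ℕ) : ℝ) = (((2 * i + 1 : ℕ) : ℕ) : ℝ) from rfl, ← hj, hΦc, hQ₀, sub_newtonPolyOdd_eval]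
    have hiT : i ≤ (T - 1) / 2 := by omega
    have hfun : (fun j => Φ₀ (2 * j + 1)) = fun j => Φ (2 * (j + i₀) + 1) := by
      funext j'; rw [hΦ₀]; simp only; congr 1; ring
    calc |newtonRem D' i (fun j => Φ₀ (2 * j + 1))|
        ≤ ((i.choose (D' + 1) : ℕ) : ℝ) * K :=
          abs_newtonRem_le D' i _ fun j' hj' => by rw [hfun]; exact hK j' (by omega)
      _ ≤ ((((T - 1) / 2).choose (D' + 1) : ℕ) : ℝ) * K :=
          mul_le_mul_of_nonneg_right (Nat.cast_le.2 (Nat.choose_le_choose _ hiT)) hK0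
  calc |∑ c ∈ C, w c * (p.eval (c : ℝ) * (Φ c - Q.eval (c : ℝ)))|
      ≤ ∑ c ∈ C, |w c * (p.eval (c : ℝ) * (Φ c - Q.eval (c : ℝ)))| := abs_sum_le_sum_abs _ _
    _ ≤ ∑ c ∈ C, |w c| * (P * (((((T - 1) / 2).choose (D' + 1) : ℕ) : ℝ) * K)) := sum_le_sum fun c hc => by
        rw [abs_mul]
        exact mul_le_mul_of_nonneg_left (hterm c hc) (abs_nonneg _)
    _ = (∑ c ∈ C, |w c|) * (P * (((((T - 1) / 2).choose (D' + 1) : ℕ) : ℝ) * K)) := by rw [sum_mul]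
    _ ≤ B * (P * (((((T - 1) / 2).choose (D' + 1) : ℕ) : ℝ) * K)) :=
        mul_le_mul_of_nonneg_right hB (by positivity)
    _ = B * P * ((((T - 1) / 2).choose (D' + 1) : ℕ) : ℝ) * K := by ring

end ExactRuleShift

namespace IsExactDesign

variable {n t T D : ℕ} {B : ℝ} {C : Finset ℕ} {w : ℕ → ℝ}

/-- **Exact designs price polynomially weighted profiles, base-shifted form**: for `IsExactDesign n t T D B C w`, a
polynomial weight `p` with `deg p + D' ≤ D` vanishing on the levels below `2i₀+1` and `|p| ≤ P` on the levels, and a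
profile `Φ` with `|Δ^{D'+1}[j ↦ Φ(2(j+i₀)+1)](j)| ≤ K` for `2(j+i₀+D'+1)+1 ≤ T`:
`|Σ_c w_c p(c)Φ(c) + p(0)·N^{odd}_{D'}[Φ(· + 2i₀)](−2i₀)| ≤ B·P·C((T−1)/2, D'+1)·K`.
[cite: Agarwal2000DifferenceEquations, Remark 1.8.1 (1.8.8)] [cite: Rivlin1974, Sect. 1.3 (1.32)–(1.34)] -/
theorem abs_levelSum_mul_add_le_of_fwdDiff_odd_shift (h : IsExactDesign n t T D B C w)
    (p : ℝ[X]) {D' i₀ : ℕ} (hp : p.natDegree + D' ≤ D)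
    (hp0 : ∀ c ∈ C, c < 2 * i₀ + 1 → p.eval (c : ℝ) = 0) {P : ℝ} (hP : ∀ c ∈ C, |p.eval (c : ℝ)| ≤ P)
    (Φ : ℕ → ℝ) {K : ℝ} (hK0 : 0 ≤ K)
    (hK : ∀ j : ℕ, 2 * (j + i₀ + D' + 1) + 1 ≤ T →
      |((fwdDiff (1 : ℕ))^[D' + 1] (fun j => Φ (2 * (j + i₀) + 1))) j| ≤ K) :
    |∑ c ∈ C, w c * (p.eval (c : ℝ) * Φ c) +
        p.eval 0 * (newtonPolyOdd D' (fun c => Φ (c + 2 * i₀))).eval (-(2 * i₀ : ℝ))| ≤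
      B * P * ((((T - 1) / 2).choose (D' + 1) : ℕ) : ℝ) * K :=
  abs_levelSum_mul_add_le_of_exact_of_fwdDiff_odd_shift h.exact h.variation_le h.level_le
    (fun c hc => (h.2.2.2.1 c hc).1) p hp hp0 hP Φ hK0 hK

/-- **The one-sided pricing form, base-shifted**: if moreover `0 ≤ p(0)·N^{odd}_{D'}[Φ(· + 2i₀)](−2i₀)` then
`Σ_c w_c p(c)Φ(c) ≤ B·P·C((T−1)/2, D'+1)·K`.
[cite: Agarwal2000DifferenceEquations, Remark 1.8.1 (1.8.8)] [cite: Rivlin1974, Sect. 1.3 (1.32)–(1.34)] -/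
theorem levelSum_mul_le_of_fwdDiff_odd_shift (h : IsExactDesign n t T D B C w)
    (p : ℝ[X]) {D' i₀ : ℕ} (hp : p.natDegree + D' ≤ D)
    (hp0 : ∀ c ∈ C, c < 2 * i₀ + 1 → p.eval (c : ℝ) = 0) {P : ℝ} (hP : ∀ c ∈ C, |p.eval (c : ℝ)| ≤ P)
    (Φ : ℕ → ℝ) {K : ℝ} (hK0 : 0 ≤ K)
    (hK : ∀ j : ℕ, 2 * (j + i₀ + D' + 1) + 1 ≤ T →
      |((fwdDiff (1 : ℕ))^[D' + 1] (fun j => Φ (2 * (j + i₀) + 1))) j| ≤ K)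
    (hmain : 0 ≤ p.eval 0 * (newtonPolyOdd D' (fun c => Φ (c + 2 * i₀))).eval (-(2 * i₀ : ℝ))) :
    ∑ c ∈ C, w c * (p.eval (c : ℝ) * Φ c) ≤ B * P * ((((T - 1) / 2).choose (D' + 1) : ℕ) : ℝ) * K := by
  have h2 := (abs_le.1 (h.abs_levelSum_mul_add_le_of_fwdDiff_odd_shift p hp hp0 hP Φ hK0 hK)).2
  linarith

/-- **A class with no virtual weight is pure remainder**: if `p(0) = 0` (the weight vanishes at the virtual level)
then `|Σ_c w_c p(c)Φ(c)| ≤ B·P·C((T−1)/2, D'+1)·K` under the hypotheses of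
`abs_levelSum_mul_add_le_of_fwdDiff_odd_shift`.
[cite: Agarwal2000DifferenceEquations, Remark 1.8.1 (1.8.8)] [cite: Rivlin1974, Sect. 1.3 (1.32)–(1.34)] -/
theorem abs_levelSum_mul_le_of_eval_zero (h : IsExactDesign n t T D B C w)
    (p : ℝ[X]) {D' i₀ : ℕ} (hp : p.natDegree + D' ≤ D) (hpz : p.eval 0 = 0)
    (hp0 : ∀ c ∈ C, c < 2 * i₀ + 1 → p.eval (c : ℝ) = 0) {P : ℝ} (hP : ∀ c ∈ C, |p.eval (c : ℝ)| ≤ P)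
    (Φ : ℕ → ℝ) {K : ℝ} (hK0 : 0 ≤ K)
    (hK : ∀ j : ℕ, 2 * (j + i₀ + D' + 1) + 1 ≤ T →
      |((fwdDiff (1 : ℕ))^[D' + 1] (fun j => Φ (2 * (j + i₀) + 1))) j| ≤ K) :
    |∑ c ∈ C, w c * (p.eval (c : ℝ) * Φ c)| ≤ B * P * ((((T - 1) / 2).choose (D' + 1) : ℕ) : ℝ) * K := by
  have h1 := h.abs_levelSum_mul_add_le_of_fwdDiff_odd_shift p hp hp0 hP Φ hK0 hK
  rwa [hpz, zero_mul, add_zero] at h1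

end IsExactDesign

end Literature.Combinatorics.Optimization

end
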